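import Summits.PneNP.PneNP.Theorems.ChebyshevTracialDesignGammaDirectionExpWindow
import Summits.PneNP.PneNP.Theorems.ChebyshevTracialDesignGammaDirectionByType
import Summits.PneNP.PneNP.Theorems.ChebyshevTracialDesignGammaDirectionRemainder
import Summits.PneNP.PneNP.Theorems.ChebyshevTracialDesignGammaDirectionNumericsAll
import HarnessLib

/-!
# Cell pnp-psdrank, route `ChebyshevTracialDesign`: THE ASYMPTOTIC FORM OF (CG_1′) IN EVERY TYPE-CONSTANT DIRECTION
# (the γ-direction included), PER NON-ALIGNED MATCHING — brick 143 (crux `TracialDecayExp20`, stmt-PneNP-19878)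

Brick 143 (prover g29; MEMO-31 §6). Brick 126 (`…CrossingPlaneExp.crossingPlane_value_le_exp`) is the crossing-plane case `γ = 0`; (O3) of MEMO-25 §4
asked for the third type-constant direction `γ·[p, πp ∈ H]` (the `n_A`-direction, NOT a block statistic). Bricks 129–142 reduced it to brick 142
(`…GammaDirectionDischarged`), brick 143w (`…GammaDirectionExpWindow`) fixed the window and the two floors, eng's brick 143a
(`…GammaDirectionNumericsAll.gamma_numerics`) discharges every real hypothesis for `N₀^{1/8} ≥ P*(β, K)`. Here the asymptotic bookkeeping is done
once and for all, exactly as brick 126 did for brick 125: for a BALANCED block `|H| = n/2` and a NON-ALIGNED matching (`βn ≤ b_M(H) ≤ (½ − β)n` mixed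
edges, so `a = d ≥ βn/2`), every balanced exact design with `2 ≤ D`, `D⁴ ≤ n`, `2D+1 ≤ T ≤ 7⌊√n⌋`:
* **`gammaDirection_value_le_exp`**: for every `β > 0`, `a′ > 0` there is `n₀` such that for `n ≥ n₀`, `0 ≤ ψ ≤ G`, `|γ|,|λ|,|κ| ≤ 1`:
  `|PM|·Σ_U W(U,M)·ψ(|U∩H|)·(Σ_p (γ[p,πp∈H] + λ([p,πp∈H] − [p,πp∉H]) + (λ+κ)) x_p x_{πp})² ≤ 2·10⁴·(1+B_v)·G·n⁶·e^{−a′D}`.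
  Constants: margin `β₀ = min(β, 1/8)`, type parameter `β₀/2` for bricks 132/142/143a; window `ε = K√(|H|D)`, `K² = a′ + log 2` (tail `2e^{−a′D}`,
  `…GammaDirectionExpTools.tail_le`); `x`-smoothness := brick 132 (`smoothnessFamilyRS_le_of_type`, `V₀ = β₀⁴n/128`, `u = β₀`, `r₀ = ⌈β₀n/4⌉`, Chernoff
  exponent `≤ −β₀n/64` by `chernoff_exponent_le_four`), dominated on `D−1 ≤ k ≤ D+1` by `Ξ = q^{D−1} + 4^{D+1}e^{−β₀n/64}`, `q = 393216(D+1)/(β₀⁴n)`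
  (brick 126b's `numerics` verbatim); remainders := 134a `gammaRemainder_le`; reals := 143a at `LB := exp(−64(ε+11)²/((β₀/2)⁵N₀))/(128N₀²)`,
  `cV = (β₀/64)²N₀` (`half_sq_radius_eq`); last arithmetic `final_bound_gamma`.
READING: per non-aligned matching, the (CG_1′) value of every `H`-symmetric tilted mask in EVERY type-constant direction is `≤ poly(n)·e^{−a′D}` for
EVERY `a′` — (O1)+(O2)+(O3) of MEMO-25 §4 in final form; ASYMPTOTIC ONLY (`∃ n₀`), nothing effective. WHAT THIS FILE DOES NOT DO: the average over
`M` (brick 144), unbalanced blocks, general (spread) strategies; anything on `TracialDecayExp20` itself, psd rank of P_PM(K_n), or P vs NP.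
[cite: Rothvoss2017, §2 (PDF pp. 5–6)] [cite: RollinRoss2010, §3 Lemma 3.3; §4.1 Thm 4.2] [cite: Durrett2019, §2.7] [cite: Agarwal2000DifferenceEquations, Remark 1.8.1]
Stature: support/instrument (kernel lane, no defs, axioms standard). Supports stmt-PneNP-19878.
-/

set_option linter.dupNamespace false -- `Summit.PneNP.PneNP.…`: summit = sub-problem (D-0017)

noncomputable section

namespace Summit.PneNP.PneNP.Theorems.ChebyshevTracialDesignGammaDirectionExp

open Finset Literature.Barriers.PneNP Literature.Combinatorics.Optimization
open Literature.Combinatorics.Optimization.ShellStep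
open Summit.PneNP.PneNP.Theorems.ChebyshevTracialDesignGammaDirectionExpWindow (gammaDirection_value_le_window)
open Summit.PneNP.PneNP.Theorems.ChebyshevTracialDesignGammaDirectionByType (smoothnessFamilyRS_le_of_type)
open Summit.PneNP.PneNP.Theorems.ChebyshevTracialDesignGammaDirectionRemainder (gammaRemainder_le)
open Summit.PneNP.PneNP.Theorems.ChebyshevTracialDesignGammaDirectionNumericsAll (gamma_numerics)
open Summit.PneNP.PneNP.Theorems.ChebyshevTracialDesignCrossingPlaneExpTools
open Summit.PneNP.PneNP.Theorems.ChebyshevTracialDesignGammaDirectionExpTools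

variable {n : ℕ}

set_option maxHeartbeats 800000 in -- brick 126's bookkeeping (200k) + brick 143w's sixty-hypothesis instantiation in one context
/-- **(CG_1′) IN EVERY TYPE-CONSTANT DIRECTION PER NON-ALIGNED MATCHING, ASYMPTOTIC FORM (brick 143).** For every `β > 0` and
`a′ > 0` there is `n₀` such that for all `n ≥ n₀`: for every balanced exact design `(n,t,T,D,B_v,C,w)` with `2D+1 ≤ T ≤ 7⌊√n⌋`,
`2 ≤ D`, `D⁴ ≤ n`, every perfect matching `M` and BALANCED block `|H| = n/2` with `βn ≤ b_M(H) ≤ (½−β)n` mixed edges,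
every `0 ≤ ψ ≤ G` on `[0,t]` and `|γ|, |λ|, |κ| ≤ 1`:
`|PM|·Σ_U W(U,M)·ψ(|U∩H|)·(Σ_p (γ[p,πp ∈ H] + λ([p,πp ∈ H] − [p,πp ∉ H]) + (λ+κ)) x_p x_{πp})² ≤ 2·10⁴·(1+B_v)·G·n⁶·e^{−a′D}`.
[cite: Rothvoss2017, §2 (PDF p. 6)] [cite: RollinRoss2010, §3 Lemma 3.3; §4.1 Thm 4.2] [cite: Durrett2019, §2.7] -/
theorem gammaDirection_value_le_exp {β a' : ℝ} (hβ : 0 < β) (ha' : 0 < a') :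
    ∃ n₀ : ℕ, ∀ n : ℕ, n₀ ≤ n → ∀ {t T D : ℕ} {Bv : ℝ} {C : Finset ℕ} {w : ℕ → ℝ},
    IsExactDesign n t T D Bv C w → 2 * D + 1 ≤ T → n ≤ 4 * t → 2 ≤ D → D ^ 4 ≤ n → T ≤ 7 * Nat.sqrt n →
    ∀ (M : PMatch n) (H : Finset (Fin n)), 2 * H.card = n →
    β * n ≤ (reps M.2.partner (vBH M.2.partner univ H ∪ vBN M.2.partner univ H)).card →
    ((reps M.2.partner (vBH M.2.partner univ H ∪ vBN M.2.partner univ H)).card : ℝ) ≤ (1 / 2 - β) * n →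
    ∀ (ψ : ℤ → ℝ) {G : ℝ}, 0 ≤ G → (∀ x ∈ Icc (0 : ℤ) ((t : ℕ) : ℤ), |ψ x| ≤ G) →
    (∀ x ∈ Icc (0 : ℤ) ((t : ℕ) : ℤ), 0 ≤ ψ x) → ∀ (gam lam kap : ℝ), |gam| ≤ 1 → |lam| ≤ 1 → |kap| ≤ 1 →
    (Fintype.card (PMatch n) : ℝ) * ∑ U : OddSet n, levelWeight n t C w U M *
        (ψ ((U.1 ∩ H).card : ℤ) *
          (∑ p : Fin n, (gam * (if (p ∈ H ∧ M.2.partner p ∈ H) then (1 : ℝ) else 0) +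
              (lam * ((if (p ∈ H ∧ M.2.partner p ∈ H) then (1 : ℝ) else 0) -
                (if (p ∉ H ∧ M.2.partner p ∉ H) then (1 : ℝ) else 0)) + (lam + kap))) *
            ((if p ∈ U.1 then (1 : ℝ) else 0) * (if M.2.partner p ∈ U.1 then (1 : ℝ) else 0))) ^ 2) ≤
      2 * 10 ^ 4 * (1 + Bv) * G * (n : ℝ) ^ 6 * Real.exp (-(a' * D)) := by
  -- ### constants
  obtain ⟨β₀, hβ₀def⟩ : ∃ e : ℝ, e = min β (1 / 8) := ⟨_, rfl⟩
  have hβ₀pos : 0 < β₀ := by rw [hβ₀def]; exact lt_min hβ (by norm_num)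
  have hβ₀8 : β₀ ≤ 1 / 8 := by rw [hβ₀def]; exact min_le_right _ _
  have hβ₀β : β₀ ≤ β := by rw [hβ₀def]; exact min_le_left _ _
  have hlog2 : 0 < Real.log 2 := Real.log_pos (by norm_num)
  obtain ⟨K, hKdef⟩ : ∃ K : ℝ, K = Real.sqrt (a' + Real.log 2) := ⟨_, rfl⟩
  have hK0 : 0 ≤ K := by rw [hKdef]; exact Real.sqrt_nonneg _
  have hK2 : K ^ 2 = a' + Real.log 2 := by rw [hKdef]; exact Real.sq_sqrt (by linarith)
  obtain ⟨Pstar, hPstar1, hnum⟩ := numerics hβ₀pos hβ₀8 ha'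
  obtain ⟨Pg, hPg0, hγ⟩ := gamma_numerics (β := β₀ / 2) (K := K) (by positivity) (by linarith only [hβ₀8]) hK0
  refine ⟨max (max ⌈Pstar ^ 4⌉₊ 65536) (2 * ⌈Pg ^ 8⌉₊ + 2), ?_⟩
  intro n hn t T D Bv C w hdes hDT hbal hD2 hD4 hT7 M H hH hblo hbhi ψ G hG0 hG hψ0 gam lam kap hgam hlam hkap
  have hn₁ : ⌈Pstar ^ 4⌉₊ ≤ n := le_trans (le_trans (le_max_left _ _) (le_max_left _ _)) hn
  have hn65536 : 65536 ≤ n := le_trans (le_trans (le_max_right _ _) (le_max_left _ _)) hn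
  have hnPg : 2 * ⌈Pg ^ 8⌉₊ + 2 ≤ n := le_trans (le_max_right _ _) hn
  have hnP : Pstar ^ 4 ≤ (n : ℝ) := le_trans (Nat.le_ceil _) (by exact_mod_cast hn₁)
  -- ### the quarter scale and brick 126b's numerics
  have hn1 : (1 : ℝ) ≤ n := (one_le_pow₀ hPstar1 : (1 : ℝ) ≤ Pstar ^ 4).trans hnP
  obtain ⟨hP1, hP4, hsqrt, hDle⟩ := quarter_facts hn1
  have hPstar : Pstar ≤ (n : ℝ) ^ ((4 : ℕ) : ℝ)⁻¹ := le_of_pow_le_pow_left₀ (by norm_num) (by linarith)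
    (show Pstar ^ 4 ≤ ((n : ℝ) ^ ((4 : ℕ) : ℝ)⁻¹) ^ 4 by rw [hP4]; exact hnP)
  have hP16 : (16 : ℝ) ≤ (n : ℝ) ^ ((4 : ℕ) : ℝ)⁻¹ := le_of_pow_le_pow_left₀ (by norm_num) (by linarith)
    (show (16 : ℝ) ^ 4 ≤ ((n : ℝ) ^ ((4 : ℕ) : ℝ)⁻¹) ^ 4 by rw [hP4]; exact_mod_cast (show 16 ^ 4 ≤ n by norm_num; exact hn65536))
  have hDr2 : (2 : ℝ) ≤ D := by exact_mod_cast hD2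
  have hDr1 : (1 : ℝ) ≤ D := by linarith only [hDr2]
  have hD0 : (0 : ℝ) ≤ D := by linarith only [hDr2]
  have hD1 : 1 ≤ D := by omega
  have hDP : (D : ℝ) ≤ (n : ℝ) ^ ((4 : ℕ) : ℝ)⁻¹ := hDle D hD0 (by exact_mod_cast hD4)
  have hT0 : (0 : ℝ) ≤ T := Nat.cast_nonneg _
  have hTP : (T : ℝ) ≤ 7 * ((n : ℝ) ^ ((4 : ℕ) : ℝ)⁻¹) ^ 2 := by
    have h1 : ((Nat.sqrt n : ℕ) : ℝ) ≤ Real.sqrt n := Real.nat_sqrt_le_real_sqrt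
    have h2 : (T : ℝ) ≤ 7 * (Nat.sqrt n : ℕ) := by exact_mod_cast hT7
    rw [← hsqrt]; linarith only [h1, h2]
  obtain ⟨c1, c2, c3, c4, c5, c6, c7, c8, c9⟩ := hnum _ hPstar D T hDr1 hDP hT0 hTP
  have c4' := num_four' hP16 hTP
  rw [hP4] at c1 c2 c3 c4 c5 c6 c7 c8 c9 c4'
  have h8 : β₀ * n ≤ 1 / 8 * n := mul_le_mul_of_nonneg_right hβ₀8 (Nat.cast_nonneg (α := ℝ) n)
  -- ### the type of `M` (no `set` abbreviation for the partner map: MEMO-27 §2)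
  have hπ : ∀ v, M.2.partner (M.2.partner v) = v := partner_partner M
  have hπ' : ∀ v, M.2.partner v ≠ v := partner_ne M
  have hst : ∀ v ∈ (univ : Finset (Fin n)), M.2.partner v ∈ univ := fun v _ => mem_univ _
  obtain ⟨a, ha⟩ : ∃ a : ℕ, (reps M.2.partner (vAA M.2.partner univ H)).card = a := ⟨_, rfl⟩
  obtain ⟨b, hb⟩ : ∃ b : ℕ, (reps M.2.partner (vBH M.2.partner univ H ∪ vBN M.2.partner univ H)).card = b := ⟨_, rfl⟩
  obtain ⟨d, hd⟩ : ∃ d : ℕ, (reps M.2.partner (vDD M.2.partner univ H)).card = d := ⟨_, rfl⟩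
  obtain ⟨N₀, hN⟩ : ∃ N : ℕ, a + b + d = N := ⟨_, rfl⟩
  have hn2 : n = 2 * N₀ := by
    have h := two_mul_typeReps_eq_card hπ hπ' hst H; rw [ha, hb, hd, card_univ, Fintype.card_fin] at h; omega
  have hHab : H.card = 2 * a + b := by have := card_eq_two_mul_add_of_types hπ hπ' H; rw [ha, hb] at this; exact this
  have had : d = a := by omega
  have hHN : H.card = N₀ := by omega
  rw [hb] at hblo hbhi
  have hnr : (n : ℝ) = 2 * N₀ := by exact_mod_cast hn2
  have hN₀r : (N₀ : ℝ) = (n : ℝ) / 2 := by rw [hnr]; ring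
  have har : (a : ℝ) = ((n : ℝ) / 2 - b) / 2 := by
    have : ((2 * (2 * a + b) : ℕ) : ℝ) = n := by exact_mod_cast (show 2 * (2 * a + b) = n by omega)
    push_cast at this; linarith only [this]
  have hbN : (b : ℝ) ≤ (n : ℝ) / 2 := by
    have : ((2 * b : ℕ) : ℝ) ≤ n := mod_cast (show 2 * b ≤ n by omega); push_cast at this; linarith only [this]
  have hac : ((reps M.2.partner (vAA M.2.partner univ H)).card : ℝ) = a := by exact_mod_cast ha
  have hbc : ((reps M.2.partner (vBH M.2.partner univ H ∪ vBN M.2.partner univ H)).card : ℝ) = b := by exact_mod_cast hb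
  have hdc : ((reps M.2.partner (vDD M.2.partner univ H)).card : ℝ) = a := by rw [← had]; exact_mod_cast hd
  -- `b ≥ β₀ n`, `a = d ≥ β₀ n/2`
  have hβn : 0 ≤ β₀ * n := by positivity
  have hbβ₀ : β₀ * n ≤ b := le_trans (mul_le_mul_of_nonneg_right hβ₀β (Nat.cast_nonneg _)) hblo
  have haβ₀ : β₀ * n / 2 ≤ a := by
    have : (b : ℝ) ≤ (1 / 2 - β₀) * n := hbhi.trans (mul_le_mul_of_nonneg_right (by linarith only [hβ₀β]) (Nat.cast_nonneg _))
    rw [har]; linarith only [this]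
  -- ### design data
  have hBv : 0 ≤ Bv := le_trans (sum_nonneg fun c _ => abs_nonneg _) hdes.2.2.2.2.2.2
  have htn : 2 * t + 2 ≤ n := hdes.2.1
  have hTt : T ≤ t := hdes.2.2.1
  obtain ⟨s, hs2⟩ : ∃ s : ℕ, t = 2 * s + 1 := hdes.1
  have htr : (t : ℝ) = 2 * s + 1 := by exact_mod_cast hs2
  have httr : (t : ℝ) ≤ n := by exact_mod_cast (show t ≤ n by omega)
  have httlo : (n : ℝ) / 2 / 2 ≤ (t : ℝ) := by
    have : (n : ℝ) ≤ 4 * (t : ℝ) := mod_cast hbal; linarith only [this]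
  have httN : (t : ℝ) ≤ (n : ℝ) / 2 - 1 := by
    have : ((2 * t + 2 : ℕ) : ℝ) ≤ n := mod_cast htn; push_cast at this; linarith only [this]
  -- the naturals of brick 142
  have ha2 : 2 ≤ a := by exact_mod_cast (show (2 : ℝ) ≤ a by linarith only [haβ₀, c1, hD0])
  obtain ⟨N₁, hN01⟩ : ∃ N₁ : ℕ, N₁ + 1 = N₀ := ⟨N₀ - 1, by omega⟩
  obtain ⟨N₂, hN12⟩ : ∃ N₂ : ℕ, N₂ + 1 = N₁ := ⟨N₁ - 1, by omega⟩
  obtain ⟨s₁, hs₁⟩ : ∃ s₁ : ℕ, s₁ + 1 = s := ⟨s - 1, by omega⟩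
  obtain ⟨s₂, hs₂'⟩ : ∃ s₂ : ℕ, s₂ + 1 = s₁ := ⟨s₁ - 1, by omega⟩
  obtain ⟨r, hr⟩ : ∃ r : ℕ, r + 3 = s := ⟨s - 3, by omega⟩
  obtain ⟨a₂, haa⟩ : ∃ a₂ : ℕ, a₂ + 2 = a := ⟨a - 2, by omega⟩
  have hN₂r : (N₂ : ℝ) = (N₀ : ℝ) - 2 := by
    have : ((N₂ + 2 : ℕ) : ℝ) = N₀ := mod_cast (show N₂ + 2 = N₀ by omega); push_cast at this; linarith only [this]
  have hs₂r : (s₂ : ℝ) = (s : ℝ) - 2 := by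
    have : ((s₂ + 2 : ℕ) : ℝ) = s := mod_cast (show s₂ + 2 = s by omega); push_cast at this; linarith only [this]
  -- ### the window `ε = K√(|H|D)`, the floor `LB`, the scale `P₈ = N₀^{1/8}`
  have hHr : (H.card : ℝ) = N₀ := by exact_mod_cast hHN
  have hHpos : (0 : ℝ) < H.card := by rw [hHr, hN₀r]; linarith only [hn1]
  obtain ⟨ε, hεdef⟩ : ∃ e : ℝ, e = K * Real.sqrt (H.card * D) := ⟨_, rfl⟩
  have hε0 : 0 ≤ ε := by rw [hεdef]; exact mul_nonneg hK0 (Real.sqrt_nonneg _)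
  have hεK : ε ≤ K * Real.sqrt (2 * N₀ * D) := by
    rw [hεdef, hHr]; exact mul_le_mul_of_nonneg_left (Real.sqrt_le_sqrt (by nlinarith only [hD0, hN₀r, hn1])) hK0
  obtain ⟨P₈, hP₈def⟩ : ∃ P : ℝ, P = (N₀ : ℝ) ^ ((8 : ℕ) : ℝ)⁻¹ := ⟨_, rfl⟩
  have hP₈8 : (N₀ : ℝ) = P₈ ^ 8 := by
    rw [hP₈def]; exact (Real.rpow_inv_natCast_pow (Nat.cast_nonneg _) (by norm_num)).symm
  have hPg8 : Pg ≤ (N₀ : ℝ) ^ ((8 : ℕ) : ℝ)⁻¹ := by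
    have h1 : Pg ^ 8 ≤ (N₀ : ℝ) := by
      have h2 : ((2 * ⌈Pg ^ 8⌉₊ + 2 : ℕ) : ℝ) ≤ n := by exact_mod_cast hnPg
      push_cast at h2
      linarith only [h2, Nat.le_ceil (Pg ^ 8), hN₀r]
    calc Pg = (Pg ^ 8) ^ ((8 : ℕ) : ℝ)⁻¹ := (Real.pow_rpow_inv_natCast hPg0 (by norm_num)).symm
      _ ≤ (N₀ : ℝ) ^ ((8 : ℕ) : ℝ)⁻¹ := Real.rpow_le_rpow (by positivity) h1 (by positivity)
  obtain ⟨LB, hLBdef⟩ : ∃ e : ℝ, e = Real.exp (-(64 * (ε + 11) ^ 2 / ((β₀ / 2) ^ 5 * (N₀ : ℝ)))) / (128 * (N₀ : ℝ) ^ 2) := ⟨_, rfl⟩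
  have hN₀pos : (0 : ℝ) < N₀ := by rw [hN₀r]; linarith only [hn1]
  have hLB : 0 < LB := by rw [hLBdef]; positivity
  -- ### eng's numerics (brick 143a)
  have hD4r : ((D : ℝ)) ^ 4 ≤ 2 * N₀ := by rw [← hnr]; exact_mod_cast hD4
  have hbal' : n ≤ 4 * (2 * s + 1) := by omega
  have htn' : 2 * (2 * s + 1) + 2 ≤ n := by omega
  obtain ⟨L, E, Far, Γ, q, cV, hDN, h2D, hLN, hq1, hq2, hq3, hq4, hq5, h2Lx, hLxN, hLx1, hLx2, hwin, hN4, hkV, hE0, hFar0,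
    hE, hFar, hΓ₀, hΓ₁, hΓ₂, hq₀, hq₁, hq₂, hqh, hcV, hεA, hεB, hεC, hsS, hs', hsn, hcVeq, hsmall, hε36⟩ :=
    hγ n N₀ N₁ N₂ D a s r ε LB hN01 hN12 hr hn2 hPg8 hD1 hD4r (by omega) hbal' htn' hε0 hεK (le_of_eq hLBdef.symm)
  -- ### the `x`-smoothness family by type (brick 132), dominated by the constant `Ξ`
  obtain ⟨V₀, hV₀def⟩ : ∃ e : ℝ, e = β₀ ^ 4 * n / 128 := ⟨_, rfl⟩
  have hV₀pos : 0 < V₀ := by rw [hV₀def]; positivity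
  obtain ⟨r₀, hr₀def⟩ : ∃ r : ℕ, r = ⌈β₀ * (n : ℝ) / 4⌉₊ := ⟨_, rfl⟩
  have hr₀ge : β₀ * (n : ℝ) / 4 ≤ r₀ := by rw [hr₀def]; exact Nat.le_ceil _
  have hr₀lt : (r₀ : ℝ) < β₀ * ((n : ℝ) / 2) / 2 + 1 := by
    rw [hr₀def]; have := Nat.ceil_lt_add_one (show 0 ≤ β₀ * (n : ℝ) / 4 by positivity); linarith only [this]
  have hm3 : 3 ≤ n - 4 * (D + 1) - 4 := by
    have : 4 * D + 11 ≤ n := Nat.cast_le.1 ((show ((4 * D + 11 : ℕ) : ℝ) ≤ n by push_cast; exact c9)); omega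
  have hmn : n - 4 * (D + 1) - 4 + 4 * (D + 1) + 4 ≤ n := by omega
  -- the margins of brick 132 (`β₁ = β₀/2`)
  have hSlo : (n : ℝ) / 4 + β₀ * n / 2 ≤
      ((reps M.2.partner (vBH M.2.partner univ H ∪ vBN M.2.partner univ H)).card : ℝ) +
        (reps M.2.partner (vDD M.2.partner univ H)).card := by
    rw [hbc, hdc, har]; linarith only [hbβ₀]
  have hShi : ((reps M.2.partner (vBH M.2.partner univ H ∪ vBN M.2.partner univ H)).card : ℝ) +
      (reps M.2.partner (vDD M.2.partner univ H)).card ≤ (n : ℝ) / 2 := by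
    rw [hbc, hdc, har]; linarith only [hbN]
  have hβS : β₀ / 2 * (((reps M.2.partner (vBH M.2.partner univ H ∪ vBN M.2.partner univ H)).card : ℝ) +
      (reps M.2.partner (vDD M.2.partner univ H)).card) ≤ β₀ / 2 * ((n : ℝ) / 2) :=
    mul_le_mul_of_nonneg_left hShi (by positivity)
  have hbT : β₀ / 2 * (((reps M.2.partner (vBH M.2.partner univ H ∪ vBN M.2.partner univ H)).card : ℝ) +
      (reps M.2.partner (vDD M.2.partner univ H)).card) + T + 2 * (D + 2) ≤
      (reps M.2.partner (vBH M.2.partner univ H ∪ vBN M.2.partner univ H)).card := by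
    linarith only [hβS, hbc, hbβ₀, c2]
  have hdT : β₀ / 2 * (((reps M.2.partner (vBH M.2.partner univ H ∪ vBN M.2.partner univ H)).card : ℝ) +
      (reps M.2.partner (vDD M.2.partner univ H)).card) + T + 2 * (D + 2) ≤
      (reps M.2.partner (vDD M.2.partner univ H)).card := by
    linarith only [hβS, hdc, haβ₀, c2]
  have hr₀' : β₀ / 2 * (((reps M.2.partner (vBH M.2.partner univ H ∪ vBN M.2.partner univ H)).card : ℝ) +
      (reps M.2.partner (vDD M.2.partner univ H)).card) ≤ r₀ := by linarith only [hβS, hr₀ge]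
  have hsT : (t : ℝ) / 2 +
      β₀ / 2 * (((reps M.2.partner (vBH M.2.partner univ H ∪ vBN M.2.partner univ H)).card : ℝ) +
        (reps M.2.partner (vDD M.2.partner univ H)).card) + 2 * T + 4 * (D + 2) + 2 ≤
      ((reps M.2.partner (vBH M.2.partner univ H ∪ vBN M.2.partner univ H)).card : ℝ) +
        (reps M.2.partner (vDD M.2.partner univ H)).card := by
    linarith only [hβS, hSlo, httN, c2]
  have hV₀le : V₀ ≤ (β₀ / 2) ^ 4 * ((((reps M.2.partner (vBH M.2.partner univ H ∪ vBN M.2.partner univ H)).card : ℝ) +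
      (reps M.2.partner (vDD M.2.partner univ H)).card) - 4 * (D + 2) - 2 * T) := by
    rw [hV₀def]
    have hle : (n : ℝ) / 8 ≤ (((reps M.2.partner (vBH M.2.partner univ H ∪ vBN M.2.partner univ H)).card : ℝ) +
        (reps M.2.partner (vDD M.2.partner univ H)).card) - 4 * (D + 2) - 2 * T := by
      linarith only [hSlo, c2, h8, hβn]
    calc β₀ ^ 4 * n / 128 = β₀ ^ 4 / 16 * ((n : ℝ) / 8) := by ring
      _ ≤ β₀ ^ 4 / 16 * ((((reps M.2.partner (vBH M.2.partner univ H ∪ vBN M.2.partner univ H)).card : ℝ) +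
          (reps M.2.partner (vDD M.2.partner univ H)).card) - 4 * (D + 2) - 2 * T) :=
          mul_le_mul_of_nonneg_left hle (by positivity)
      _ = _ := by ring
  have hkV' : (2 * (D + 1 : ℕ) : ℝ) - 1 ≤ 2 * V₀ := by rw [hV₀def]; push_cast; linarith only [c3]
  have hNT : (T : ℝ) + 2 < (n : ℝ) / 2 := by linarith only [c4, hn1]
  -- `Ξ` and the dominating family `X`
  obtain ⟨qq, hqqdef⟩ : ∃ e : ℝ, e = 393216 * ((D : ℝ) + 1) / (β₀ ^ 4 * n) := ⟨_, rfl⟩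
  have hqq0 : 0 ≤ qq := by rw [hqqdef]; positivity
  have hqqV : 3072 * ((D : ℝ) + 1) / V₀ = qq := by rw [hqqdef, hV₀def]; field_simp; ring
  have hqq1 : qq ≤ 1 := by rw [hqqdef]; refine c6.trans ?_; rw [Real.exp_le_one_iff]; linarith only [ha']
  obtain ⟨τ₀, hτ₀def⟩ : ∃ e : ℝ, e = Real.exp (-(β₀ * ((n : ℝ) / 2) / 32)) := ⟨_, rfl⟩
  have hτ₀pos : 0 < τ₀ := by rw [hτ₀def]; exact Real.exp_pos _
  obtain ⟨Ξ, hΞdef⟩ : ∃ e : ℝ, e = qq ^ (D - 1) + (4 : ℝ) ^ (D + 1) * τ₀ := ⟨_, rfl⟩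
  have hΞ0 : 0 ≤ Ξ := by rw [hΞdef]; positivity
  -- the Chernoff exponent (`T+4` margin, brick 132)
  have hCh : (β₀ + β₀ ^ 2) * ((t : ℝ) / 2 *
      (reps M.2.partner (vAA M.2.partner univ H)).card / ((n : ℝ) / 2 - T - 2)) -
      β₀ * (((t : ℝ) - T - 4) / 2 + 1 - r₀) ≤ -(β₀ * ((n : ℝ) / 2) / 32) := by
    refine chernoff_exponent_le_four hβ₀pos hβ₀8 (Nat.cast_nonneg _) ?_ hT0 ?_ ?_ httlo hr₀lt
    · rw [hac, har]; linarith only [hbβ₀]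
    · linarith only [c2, hD0, hβn]
    · linarith only [c4']
  have hdom : ∀ k : ℕ, D - 1 ≤ k → k ≤ D + 1 →
      (2 * Real.sqrt 192 * Real.sqrt (4 * k / V₀)) ^ (2 * k) +
        (4 : ℝ) ^ k * Real.exp ((β₀ + β₀ ^ 2) * ((t : ℝ) / 2 *
          (reps M.2.partner (vAA M.2.partner univ H)).card / ((n : ℝ) / 2 - T - 2)) -
          β₀ * (((t : ℝ) - T - 4) / 2 + 1 - r₀)) ≤ Ξ := by
    intro k hk1 hk2
    rw [hΞdef]
    refine add_le_add ?_ ?_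
    · have e1 : (2 * Real.sqrt 192 * Real.sqrt (4 * k / V₀)) ^ (2 * k) = (3072 * k / V₀) ^ k := by
        have h192 : Real.sqrt 192 ^ 2 = 192 := Real.sq_sqrt (by norm_num)
        have hxx : Real.sqrt (4 * k / V₀) ^ 2 = 4 * k / V₀ := Real.sq_sqrt (by positivity)
        rw [pow_mul, show (2 * Real.sqrt 192 * Real.sqrt (4 * k / V₀)) ^ 2 = 3072 * k / V₀ by rw [mul_pow, mul_pow, h192, hxx]; ring]
      rw [e1]
      have hkq : 3072 * (k : ℝ) / V₀ ≤ qq := by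
        have : (k : ℝ) ≤ (D + 1 : ℕ) := by exact_mod_cast hk2
        rw [← hqqV]; push_cast at this; exact div_le_div_of_nonneg_right (by linarith only [this]) hV₀pos.le
      calc (3072 * (k : ℝ) / V₀) ^ k ≤ qq ^ k := pow_le_pow_left₀ (by positivity) hkq k
        _ ≤ qq ^ (D - 1) := pow_le_pow_of_le_one hqq0 hqq1 hk1
    · refine mul_le_mul (pow_le_pow_right₀ (by norm_num) hk2) ?_ (Real.exp_pos _).le (by positivity)
      rw [hτ₀def]; exact Real.exp_le_exp.2 hCh
  obtain ⟨X, hX⟩ : ∃ X : ℕ → ℝ, ∀ k, X k = max Ξ ((2 * Real.sqrt 192 * Real.sqrt (4 * k / V₀)) ^ (2 * k) +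
      (4 : ℝ) ^ k * Real.exp ((β₀ + β₀ ^ 2) * ((t : ℝ) / 2 *
        (reps M.2.partner (vAA M.2.partner univ H)).card / ((n : ℝ) / 2 - T - 2)) -
        β₀ * (((t : ℝ) - T - 4) / 2 + 1 - r₀))) := ⟨_, fun k => rfl⟩
  have hX0 : ∀ k, 0 ≤ X k := fun k => by rw [hX]; exact hΞ0.trans (le_max_left _ _)
  have h132 := smoothnessFamilyRS_le_of_type M H (t := t) (T := T) (D := D) (by omega) (by omega)
    (β := β₀ / 2) (V₀ := V₀) (u := β₀) (by positivity) hV₀pos hβ₀pos.le (by linarith only [hβ₀8]) r₀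
    hkV' hbT hdT hr₀' hsT hV₀le hNT
  have hXfam : ∀ k, k ≤ D + 1 → ∀ r' s' : ℕ, r' ≤ 2 → r' ≤ s' → s' ≤ 2 * r' → ∀ c' : ℕ, c' + 2 * k ≤ T →
      ∀ S' : Finset (Fin n), (∀ u ∈ S', M.2.partner u ∈ S') → S'.card + 4 * k + 2 * r' = n →
      ∑ x ∈ Icc (0 : ℤ) ((t - s' : ℕ) : ℤ),
        |nab2^[k] (fun c x => shellLaw M.2.partner S' H (t - s' - 2 * k) c x : Profile) c' x| ≤ X k :=
    fun k hk r' s' hr' hrs hsr c' hc' S' hS' hcard =>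
      (h132 k hk r' s' hr' hrs hsr c' hc' S' hS' hcard).trans (by rw [hX]; exact le_max_right _ _)
  have eU : X (D + 1) = Ξ := by rw [hX]; exact max_eq_left (hdom (D + 1) (by omega) le_rfl)
  have eM : X D = Ξ := by rw [hX]; exact max_eq_left (hdom D (by omega) (by omega))
  have eL : X (D - 1) = Ξ := by rw [hX]; exact max_eq_left (hdom (D - 1) le_rfl (by omega))
  -- ### the derived hypotheses of brick 143w
  have hT4 : T + 4 ≤ t := by exact_mod_cast (show (T : ℝ) + 4 ≤ t by linarith only [c4', httlo])
  have h4t : 2 * (D + 1) + 4 ≤ t := by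
    exact_mod_cast (show 2 * ((D : ℝ) + 1) + 4 ≤ t by linarith only [c1, h8, httlo, hn1])
  have hbβ' : β₀ / 2 * N₀ + 2 * D + 1 ≤ b := by rw [hN₀r]; linarith only [hbβ₀, c1, h8, hβn]
  have hdβ' : β₀ / 2 * N₀ + 2 * D + 1 ≤ d := by rw [hN₀r, had]; linarith only [haβ₀, c1, h8, hβn]
  have haβ1 : β₀ / 2 * N₀ + 1 ≤ a := by rw [hN₀r]; linarith only [haβ₀, c1, h8, hβn, hD0]
  have hs142 : β₀ / 2 * N₂ + D ≤ s₂ := by rw [hs₂r]; linarith only [hsS]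
  have hDs : D ≤ s₂ := by
    have h0 : 0 ≤ β₀ / 2 * (N₂ : ℝ) := by positivity
    exact_mod_cast (show (D : ℝ) ≤ s₂ by linarith only [hs142, h0])
  have hsn' : 2 * s + 2 * D + 2 ≤ n := by exact_mod_cast hsn
  have hfloor : 2 * (D : ℝ) + 4 ≤ (2 * (s : ℝ) + 1) * H.card / n - ε := by
    rw [show (2 * (s : ℝ) + 1) * H.card / n = (2 * (s : ℝ) + 1) / 2 by rw [hHr, hnr]; field_simp]
    have hN₂N : (N₂ : ℝ) ≤ N₀ := by rw [hN₂r]; linarith only [hN₀pos]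
    have hb2 : (β₀ / 2) ^ 2 * (N₂ : ℝ) ≤ 1 / 4 * N₀ := by
      have : (β₀ / 2) ^ 2 ≤ 1 / 4 := by nlinarith only [hβ₀pos, hβ₀8]
      exact mul_le_mul this hN₂N (Nat.cast_nonneg _) (by norm_num)
    rw [hN₀r] at hb2
    linarith only [hq1, h2D, hD0, hb2, httlo, htr, hDr1]
  rw [← hP₈def] at hcVeq hsmall
  have hcVle : cV ≤ (β₀ / 2 / 32) ^ 2 * P₈ ^ 8 := by rw [hcVeq, half_sq_radius_eq]
  rw [hP₈8] at hsmall
  have hψG : ∀ x ∈ Icc (0 : ℤ) (t : ℤ), ψ x ≤ G := fun x hx => (le_abs_self _).trans (hG x hx)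
  -- ### brick 143w
  have h := gammaDirection_value_le_window hdes hDT hT4 h4t M H ψ hG0 hψ0 hψG gam lam kap hgam hlam hkap hm3 hmn X hX0 hXfam
    hs2 hN01 hN12 hs₁ hs₂' hr haa ha hb hd hN hn2 (by positivity) (by linarith only [hβ₀8]) hD1 hDN hbβ' hdβ' hs142 hs' hDs hsn' h2D hLN hq1 hq2 hq3 hq4
    hq5 h2Lx hLxN hLx1 hLx2 hwin hN4 hkV hE0 hFar0 hE hFar hΓ₀ hΓ₁ hΓ₂ hq₀ hq₁ hq₂ hqh hε0 hfloor haβ1 hP₈8 hsmall hε36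
    hcV hLB hcVle (le_of_eq hLBdef) hεA hεB hεC
  rw [eU, eM, eL] at h
  -- ### collapse the remainders (brick 134a)
  have hm3r : (3 : ℝ) ≤ ((n - 4 * (D + 1) - 4 : ℕ) : ℝ) := by exact_mod_cast hm3
  have hρ0 : (0 : ℝ) ≤ ((n - 4 * (D + 1) - 4 : ℕ) : ℝ) / (4 * (((n - 4 * (D + 1) - 4 : ℕ) : ℝ) - 2)) := by
    have : (0 : ℝ) < 4 * (((n - 4 * (D + 1) - 4 : ℕ) : ℝ) - 2) := by linarith only [hm3r]
    positivity
  have hρ1 : ((n - 4 * (D + 1) - 4 : ℕ) : ℝ) / (4 * (((n - 4 * (D + 1) - 4 : ℕ) : ℝ) - 2)) ≤ 1 := by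
    rw [div_le_one (by linarith only [hm3r])]; linarith only [hm3r]
  have hHn : (H.card : ℝ) / n ≤ 1 := by
    rw [div_le_one (by linarith only [hn1])]
    exact_mod_cast (show H.card ≤ n by omega)
  have hn4 : (4 : ℝ) ≤ n := by linarith only [c9, hD0]
  have hnn2 : (0 : ℝ) < (n : ℝ) * ((n : ℝ) - 2) := by nlinarith only [hn4]
  have hH2 : (H.card : ℝ) ^ 2 / ((n : ℝ) * ((n : ℝ) - 2)) ≤ 1 := by
    rw [div_le_one hnn2, hHr, hN₀r]; nlinarith only [hn4]
  have hH20 : 0 ≤ (H.card : ℝ) ^ 2 / ((n : ℝ) * ((n : ℝ) - 2)) := div_nonneg (sq_nonneg _) hnn2.le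
  have hTt' : (T : ℝ) ≤ (t : ℝ) := by exact_mod_cast hTt
  have hDt : 2 * (D : ℝ) + 2 ≤ (t : ℝ) := by
    have : ((2 * (D + 1) + 4 : ℕ) : ℝ) ≤ t := mod_cast h4t; push_cast at this; linarith only [this]
  have hR := gammaRemainder_le (Bv := Bv) (Cb := ((((T - 1) / 2).choose (D + 1) : ℕ) : ℝ))
    (tt := (t : ℝ)) (G := G)
    (r₁ := (((n - 4 * (D + 1) - 4 : ℕ) : ℝ) / (4 * (((n - 4 * (D + 1) - 4 : ℕ) : ℝ) - 2))) ^ (D + 1))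
    (r₂ := (((n - 4 * (D + 1) - 4 : ℕ) : ℝ) / (4 * (((n - 4 * (D + 1) - 4 : ℕ) : ℝ) - 2))) ^ D)
    (r₃ := (((n - 4 * (D + 1) - 4 : ℕ) : ℝ) / (4 * (((n - 4 * (D + 1) - 4 : ℕ) : ℝ) - 2))) ^ (D - 1))
    (Ξ := Ξ) (cD := (((2 * D).choose D : ℕ) : ℝ) / (4 : ℝ) ^ D) (DD := (D : ℝ)) (TT := (T : ℝ))
    (h := (H.card : ℝ) / n) (h₂ := (H.card : ℝ) ^ 2 / ((n : ℝ) * ((n : ℝ) - 2)))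
    hBv (Nat.cast_nonneg _) hG0 (pow_nonneg hρ0 _) (pow_nonneg hρ0 _) (pow_nonneg hρ0 _) hΞ0 hD0 hT0
    (div_nonneg (Nat.cast_nonneg _) (Nat.cast_nonneg _)) hH20 (pow_le_one₀ hρ0 hρ1) (pow_le_one₀ hρ0 hρ1) (pow_le_one₀ hρ0 hρ1)
    (centralBinom_div_four_pow_le_one' D) hHn hH2 hTt' hDt
  -- ### the tail
  have htail : (2 : ℝ) ^ (D + 1) * G * (2 * (n : ℝ) + 3 * (t : ℝ)) ^ 2 *
      (((D : ℝ) + 1) * (2 * ((n : ℝ) / 2 + 1) ^ 3 * Real.exp (-(ε ^ 2 / H.card)))) ≤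
      100 * G * (n : ℝ) ^ 6 * Real.exp (-(a' * D)) := by
    rw [hεdef]
    exact tail_le hK2 hHpos hG0 (Nat.cast_nonneg _) httr (by linarith only [c9, hD0]) hn4
  -- ### the four exponential comparisons
  have hTqq : (T : ℝ) * qq ≤ Real.exp (-(2 * a')) := by
    rw [hqqdef]; exact le_trans (mul_le_mul_of_nonneg_right hTP (by positivity)) c5
  have hCb : ((((T - 1) / 2).choose (D + 1) : ℕ) : ℝ) ≤ (T : ℝ) ^ (D + 1) := by
    have h1 : ((T - 1) / 2).choose (D + 1) ≤ ((T - 1) / 2) ^ (D + 1) := Nat.choose_le_pow _ _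
    have h2 : ((T - 1) / 2) ^ (D + 1) ≤ T ^ (D + 1) := Nat.pow_le_pow_left (by omega) _
    exact_mod_cast h1.trans h2
  have hm1' : qq ^ (D - 1) ≤ Real.exp (-(a' * D)) := pow_pred_le_exp hqq0 (hqqdef ▸ c6) ha'.le hD2
  have hm2' : ((((T - 1) / 2).choose (D + 1) : ℕ) : ℝ) * qq ^ (D - 1) ≤ 49 * n * Real.exp (-(a' * D)) := by
    have hsplit : (T : ℝ) ^ (D + 1) * qq ^ (D - 1) = (T : ℝ) ^ 2 * ((T : ℝ) * qq) ^ (D - 1) := by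
      rw [mul_pow, show (T : ℝ) ^ (D + 1) = (T : ℝ) ^ 2 * (T : ℝ) ^ (D - 1) by
        rw [← pow_add]; congr 1; omega]
      ring
    have hT2 : (T : ℝ) ^ 2 ≤ 49 * n := by
      have : (T : ℝ) ^ 2 ≤ (7 * ((n : ℝ) ^ ((4 : ℕ) : ℝ)⁻¹) ^ 2) ^ 2 := pow_le_pow_left₀ hT0 hTP 2
      rw [← hP4]; nlinarith only [this]
    calc ((((T - 1) / 2).choose (D + 1) : ℕ) : ℝ) * qq ^ (D - 1) ≤ (T : ℝ) ^ (D + 1) * qq ^ (D - 1) :=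
          mul_le_mul_of_nonneg_right hCb (by positivity)
      _ = (T : ℝ) ^ 2 * ((T : ℝ) * qq) ^ (D - 1) := hsplit
      _ ≤ 49 * n * Real.exp (-(a' * D)) :=
          mul_le_mul hT2 (pow_pred_le_exp (by positivity) hTqq ha'.le hD2) (by positivity) (by positivity)
  have hm3'' : (4 : ℝ) ^ (D + 1) * τ₀ ≤ Real.exp (-(a' * D)) := by
    rw [hτ₀def]; exact four_pow_mul_exp_le (by linarith only [c7])
  have hTpos : (0 : ℝ) < T := by
    have : ((2 * D + 1 : ℕ) : ℝ) ≤ T := mod_cast hDT; push_cast at this; linarith only [this, hD0]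
  have hm4' : ((((T - 1) / 2).choose (D + 1) : ℕ) : ℝ) * ((4 : ℝ) ^ (D + 1) * τ₀) ≤ Real.exp (-(a' * D)) := by
    have hc8 : ((D : ℝ) + 1) * (4 * T) + a' * D ≤ β₀ * ((n : ℝ) / 2) / 32 := by
      have : ((D : ℝ) + 1) * (4 * T) ≤ ((D : ℝ) + 1) * (4 * (7 * ((n : ℝ) ^ ((4 : ℕ) : ℝ)⁻¹) ^ 2)) :=
        mul_le_mul_of_nonneg_left (by linarith only [hTP]) (by positivity)
      linarith only [this, c8]
    calc ((((T - 1) / 2).choose (D + 1) : ℕ) : ℝ) * ((4 : ℝ) ^ (D + 1) * τ₀)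
        ≤ (T : ℝ) ^ (D + 1) * ((4 : ℝ) ^ (D + 1) * τ₀) := mul_le_mul_of_nonneg_right hCb (by positivity)
      _ = (T : ℝ) ^ (D + 1) * (4 : ℝ) ^ (D + 1) * Real.exp (-(β₀ * ((n : ℝ) / 2) / 32)) := by rw [hτ₀def]; ring
      _ ≤ Real.exp (-(a' * D)) := mul_pow_four_pow_mul_exp_le hTpos hc8
  -- ### assemble
  refine h.trans ((add_le_add hR le_rfl).trans ?_)
  rw [hΞdef]
  exact final_bound_gamma (Nat.cast_nonneg _) hG0 hBv (Nat.cast_nonneg _) (by positivity) (by positivity)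
    (Real.exp_pos _).le hD0 hm1' hm2' hm3'' hm4' (by linarith only [c9]) httr hn1 htail

end Summit.PneNP.PneNP.Theorems.ChebyshevTracialDesignGammaDirectionExp

end
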